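/-
Copyright (c) 2026 the pub-hodgecm-mathlib formalisation cell (harness21).  Prover seat hodgecm-mathlib-K2E1-p08 (g5), Track B ∕ K2-LIT, h413 =
`stmt-HodgeConjecture-24833`, campaign «EIS-RANK-ONE» rung R4 «EIS-R4-growth», road (A), file (A3) part 3∕3 (THE HEAD); DEAL BY NAME of the dealer K2E1-plan (g3)
2026-09-04T05:32:09Z ([D3]; spec of record K2E4-p11 (g3) 05:27:07Z §2–§3).
-/
import Summits.HodgeConjecture.HodgeConjecture.Theorems.K2E1SiegelIntegralExplicit      -- (A3) part 1∕3 (this seat): quantitative E4 `∫⁻_G 𝟙{H ≤ C₀} H^τ β' = K'·C₀^{τ−2}` (brings the ★ R2 chain (G0)(G)(G′)(G2)(G3))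
import Summits.HodgeConjecture.HodgeConjecture.Theorems.K2E1SiegelSetMultiplicityU3     -- (A3) part 2∕3 (this seat): multiplicity growth `m_g ≤ M₁·H(g)²`, floor, low part (brings ★ (A1), ★ (A2), ★ `exists_siegel_cover_three`)
import HarnessLib

/-!
# K2·E1 — `K2E1BorelEisensteinModerateGrowth` (rung R4 «moderate growth», road (A), file (A3), THE HEAD): ON A SIEGEL SET `𝔖 = Ω·A(t)·K` OF `U(J₃)`,
# `Σ_{γ ∈ B(F)∖G(F)} H(γ g)^τ ≤ A′ · H(g)^τ` (`τ > 2`) — HENCE `|E(f_z)(g)| ≤ ‖φ‖_∞ · A′ · H(g)^{Re z}`: THE BOREL EISENSTEIN SERIES HAS MODERATE GROWTH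

Track B ∕ K2-LIT, crux h413 = `stmt-HodgeConjecture-24833`, route of record `HCCMUnconditional`; cell `hodgecm-mathlib`, squad K2, ENGINE E1, campaign EIS-RANK-ONE rung R4
(moderate growth of the Borel Eisenstein series on Siegel sets), road (A) «Godement's count» (dealer K2E1-plan (g3) 05:32:09Z [D3]; spec K2E4-p11 (g3) 05:27:07Z; census
K2E1-p08 (g4) 05:08:07Z, K2E4-p14 (g5) 05:13:14Z).  Prover seat `hodgecm-mathlib-K2E1-p08` (g5).  THEOREMS ONLY (no `def`, no `instance`, no notation, no named-fact hypothesis,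
no `sorry`); lane `--kind proof --supports stmt-HodgeConjecture-24833 --as helper` (count-neutral, closes no socket).

THE ROAD (all inputs ★).  Godement's count ★ (G0) `K2E1GodementCount.summable_toReal_of_lintegral_weight_ne_top` gives, for every `g`,
  `Σ'_q H(γ̃_q g)^τ ≤ ((A^τ · m_g ∕ μ(C)) · ∫⁻ 𝟙{H ≤ A·C₀(g)} H^τ β' dμ).toReal`
with `C` a compact neighbourhood of `1` of smear constant `A` (★ (G) `exists_smear_borelHeight`), `C₀(g) = max (H g) (H g)⁻¹` the ceiling (★ (G) `borelHeight_toAdelic_mul_le_max_three`)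
and the multiplicity `m_g = #(G(F) ∩ (g•C)(g•C)⁻¹)`.  On `𝔖 = Ω·A(t)·K` (★ `K2E1ReductionTheoryU3.exists_siegel_cover_three`: `Ω ⊆ B(𝔸)`, `K` compact, `A(t) = val⁻¹(siegelCone 3 E t)`)
both factors grow polynomially in `H(g)`: `∫⁻ 𝟙{H ≤ C₀} H^τ β' = K'·C₀^{τ−2}` (★ part 1∕3 `K2E1SiegelIntegralExplicit`), `m_g ≤ M₁·H(g)²` and `C₀(g) ≤ c'·H(g)` (★ part 2∕3
`K2E1SiegelSetMultiplicityU3`: (A1)+(A2) on the high part, compactness on the low part, the floor `H ≥ c_𝔖`).  Hence: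
* §1 **`exists_forall_tsum_borelHeight_rpow_le_siegel`** — for `τ > 2`: `∃ A′ ≥ 0, ∀ g = ω a k ∈ 𝔖, Summable (q ↦ H(γ̃_q g)^τ) ∧ Σ'_q H(γ̃_q g)^τ ≤ A′·H(g)^τ`
  (`A′ = A^τ M₁ K' (A c')^{τ−2} ∕ μC`); the set form `exists_forall_mem_siegel_tsum_borelHeight_rpow_le` (`∀ g ∈ Ω · val⁻¹(siegelCone 3 E t) · K`, the letters of ★
  `exists_siegel_cover_three` and of ★ R6e `K2E1TruncatedEisensteinL2`); the packaged form **`exists_siegel_cover_tsum_borelHeight_rpow_le_three`** (`∃ 𝔖, G(F)·𝔖 = G(𝔸) ∧ …`) and the CM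
  instance **`…_cm_three`** (Iwasawa ★, `[L:L⁺] = 2`, `c² = 1 ≠ c` Mathlib) — the printed moderate growth `E(g, φ_s) ≪ m_P(g)^{Re s + ρ}` of Borel Eisenstein series on Siegel sets.
* §2 THE EISENSTEIN CURRENCY (R6e ∕ R7 binders): **`exists_forall_norm_eisensteinSeriesU_le_siegel`** — `‖eisensteinSeriesU (flatSectionU φ z) g‖ ≤ M_φ·A′·H(g)^{Re z}` on `𝔖` for
  `‖φ‖ ≤ M_φ`, `Re z > 2` (★ `norm_flatSectionU_le`, ★ `summable_norm_flatSectionU_of_summable`); `rpow_le_max_mul_pow_of_le` and **`exists_forall_norm_eisensteinSeriesU_le_pow_siegel`**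
  — the `n : ℕ` exponent form `‖E(f_z)(g)‖ ≤ (M_φ A″)·H(g)^n` (`n ≥ Re z`) of ★ R6e `exists_bound_low_of_moderateGrowth`'s `hmod` (floor).
Constants are per `τ` (the (G3) constant `K(τ)` is quantified inside `τ`); uniformity in `z` on strips with the worst exponent follows from `x^τ ≤ x^{τ₁} + x^{τ₂}` and is left to
the consumer.  [MoeglinWaldspurger1995 II.1.5, I.2.13; Garrett2018 §3.10–3.11; Godement1964 §8; Rogawski1990 §2.2.]

HONEST LABEL: HC_CM is proved only modulo the 7 printed citations (2 remaining named inputs: hLiu418 = `stmt-HodgeConjecture-24832`, h413 = `stmt-HodgeConjecture-24833`) until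
rung 0 closes; count-neutral helper, closes no socket.

## References
* [MoeglinWaldspurger1995] C. Mœglin, J.-L. Waldspurger, *Spectral Decomposition and Eisenstein Series* (1995), I.2.13, II.1.5 (moderate growth of Eisenstein series).
* [Garrett2018] P. Garrett, *Modern Analysis of Automorphic Forms by Example* (2018), §3.10–§3.11.
* [Godement1964] R. Godement, *Domaines fondamentaux des groupes arithmétiques*, Sém. Bourbaki 257 (1962∕63), §8.
* [Rogawski1990] J. D. Rogawski, *Automorphic Representations of Unitary Groups in Three Variables*, Ann. of Math. Stud. 123 (1990), §2.2 (p. 13).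
* [Borel1963] A. Borel, *Some finiteness properties of adele groups over number fields*, Publ. Math. IHÉS 16 (1963), §5.
-/

set_option autoImplicit false
-- the mandated namespace repeats the single-problem summit's segment (`HodgeConjecture.HodgeConjecture`)
set_option linter.dupNamespace false

noncomputable section

open MeasureTheory MeasureTheory.Measure Set Filter Topology MulAction NumberField IsDedekindDomain
open scoped ENNReal NNReal Pointwise MatrixGroups
open Literature.MeasureTheory.Group
open Literature.NumberTheory.Automorphic Literature.NumberTheory.Automorphic.UnitaryGroup
open Summit.HodgeConjecture.HodgeConjecture.Cruxes.H413.K2E1BorelEisensteinU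
open Summit.HodgeConjecture.HodgeConjecture.Cruxes.H413.K2E1GodementCount
open Summit.HodgeConjecture.HodgeConjecture.Cruxes.H413.K2E1BorelEisensteinGodementU
open Summit.HodgeConjecture.HodgeConjecture.Cruxes.H413.K2E1BorelEisensteinGodementU3
open Summit.HodgeConjecture.HodgeConjecture.Cruxes.H413.K2E1SiegelIntegralExplicit (exists_siegelIntegral_eq_mul_rpow_three)
open Summit.HodgeConjecture.HodgeConjecture.Cruxes.H413.K2E1SiegelSetMultiplicityU3 (exists_forall_ncard_le_mul_borelHeight_sq_siegel exists_floor_and_smear_siegel)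
open Summit.HodgeConjecture.HodgeConjecture.Cruxes.H413.K2E1BorelLatticeCount (subset_borelAdelic_of_image_subset)
open Summit.HodgeConjecture.HodgeConjecture.Cruxes.H413.K2E1ReductionTheoryU3 (exists_siegel_cover_three)

namespace Summit.HodgeConjecture.HodgeConjecture.Cruxes.H413.K2E1BorelEisensteinModerateGrowth

variable {F E : Type} [Field F] [NumberField F] [Field E] [NumberField E] [Algebra F E] {c : E ≃ₐ[F] E}

/-! ## §1 The head: `Σ'_q H(γ̃_q g)^τ ≤ A′ · H(g)^τ` on `𝔖 = Ω·A(t)·K` -/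

section Head

/-- **MODERATE GROWTH OF THE HEIGHT SERIES ON A SIEGEL SET.**  `[E:F] = 2`, `c² = 1 ≠ c`, Iwasawa `hIw`; `Ω ⊆ B(𝔸_F)` and `K` compact, `t > 0`, `τ > 2`.  There is `A′ ≥ 0` such that for
every `g = ω·a·k` (`ω ∈ Ω`, `adelicVal a ∈ siegelCone 3 E t`, `k ∈ K`):
  `Summable (q ↦ H(γ̃_q g)^τ)` and `Σ'_q H(γ̃_q g)^τ ≤ A′ · H(g)^τ`   (`γ̃_q = toAdelic q.out`, `q ∈ B(F)∖G(F)`).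
Proof = Godement's count with explicit constants: ★ (G0) `summable_toReal_of_lintegral_weight_ne_top` with the smear of a compact neighbourhood `C` of `1` (★ `exists_smear_borelHeight`),
the ceiling `C₀(g) = max (H g) (H g)⁻¹ ≤ c'·H(g)` (★ `borelHeight_toAdelic_mul_le_max_three`, floor ★ part 2∕3), the quantitative E4 `∫⁻ 𝟙{H ≤ A C₀} H^τ β' = K'·(A C₀)^{τ−2}` (★ part 1∕3) and the
multiplicity `m_g ≤ M₁·H(g)²` (★ part 2∕3): `Σ' ≤ (A^τ m_g ∕ μC)·K'·(A C₀)^{τ−2} ≤ A′·H(g)²·H(g)^{τ−2}`.  The printed `E(g, φ_s) ≪ m_{P}(g)^{Re s + ρ}` on Siegel sets.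
[cite: MoeglinWaldspurger1995, II.1.5 and I.2.13] [cite: Garrett2018, §3.10–3.11] [cite: Godement1964, §8] [cite: Rogawski1990, §2.2 (p. 13)] -/
theorem exists_forall_tsum_borelHeight_rpow_le_siegel (h2 : Module.finrank F E = 2) (hc : c * c = 1) (hc1 : c ≠ 1)
    (hIw : ∀ g : (quasiSplit F E c 3).Adelic, ∃ b ∈ borelAdelic F E c 3, ∃ k : (quasiSplit F E c 3).Adelic,
      adelicVal F E c 3 ((StdForm.antidiagonal 3).over E) k ∈ standardMaximalCompactGL 3 E ∧ g = b * k)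
    {Ω : Set (quasiSplit F E c 3).Adelic} (hΩc : IsCompact Ω) (hΩB : Ω ⊆ (borelAdelic F E c 3 : Set (quasiSplit F E c 3).Adelic))
    {K : Set (quasiSplit F E c 3).Adelic} (hKc : IsCompact K) {t : ℝ} (ht : 0 < t) {τ : ℝ} (hτ : 2 < τ) :
    ∃ A₁ : ℝ, 0 ≤ A₁ ∧ ∀ ω ∈ Ω, ∀ a : (quasiSplit F E c 3).Adelic, adelicVal F E c 3 ((StdForm.antidiagonal 3).over E) a ∈ siegelCone 3 E t → ∀ k ∈ K,
      Summable (fun q : Quotient (orbitRel ↥(borelU (c : E →+* E) ((StdForm.antidiagonal 3).over E)) ↥(unitaryGroupOfForm (c : E →+* E) ((StdForm.antidiagonal 3).over E))) =>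
        ((borelHeight ((quasiSplit F E c 3).toAdelic (Quotient.out q : ↥(unitaryGroupOfForm (c : E →+* E) ((StdForm.antidiagonal 3).over E))) * (ω * a * k)) : ℝ)) ^ τ) ∧
      ∑' q : Quotient (orbitRel ↥(borelU (c : E →+* E) ((StdForm.antidiagonal 3).over E)) ↥(unitaryGroupOfForm (c : E →+* E) ((StdForm.antidiagonal 3).over E))),
          ((borelHeight ((quasiSplit F E c 3).toAdelic (Quotient.out q : ↥(unitaryGroupOfForm (c : E →+* E) ((StdForm.antidiagonal 3).over E))) * (ω * a * k)) : ℝ)) ^ τ ≤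
        A₁ * ((borelHeight (ω * a * k) : ℝ)) ^ τ := by
  classical
  -- Borel structure, a Haar measure, countability and discreteness
  letI : MeasurableSpace (quasiSplit F E c 3).Adelic := borel _
  haveI : BorelSpace (quasiSplit F E c 3).Adelic := ⟨rfl⟩
  haveI : T2Space (quasiSplit F E c 3).Adelic := inferInstanceAs (T2Space (adelic F E c 3 ((StdForm.antidiagonal 3).over E)))
  haveI : SecondCountableTopology (quasiSplit F E c 3).Adelic := inferInstanceAs (SecondCountableTopology (adelic F E c 3 ((StdForm.antidiagonal 3).over E)))
  haveI : LocallyCompactSpace (quasiSplit F E c 3).Adelic := inferInstanceAs (LocallyCompactSpace (adelic F E c 3 ((StdForm.antidiagonal 3).over E)))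
  haveI : DiscreteTopology (quasiSplit F E c 3).arithmeticSubgroup := isDiscreteRational_quasiSplit
  haveI : Countable (quasiSplit F E c 3).arithmeticSubgroup := by
    haveI : Countable (quasiSplit F E c 3).Rational := countable_unitaryGroupOfForm (c := c) ((StdForm.antidiagonal 3).over E)
    exact (Set.countable_range (quasiSplit F E c 3).toAdelic).to_subtype
  haveI := countable_borelQuotient (F := F) (E := E) (c := c) (N := 3)
  haveI : DiscreteTopology ↥(borelAdelic F E c 3 ⊓ (quasiSplit F E c 3).arithmeticSubgroup) :=
    DiscreteTopology.of_subset ‹DiscreteTopology (quasiSplit F E c 3).arithmeticSubgroup› inf_le_right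
  set μ : Measure (quasiSplit F E c 3).Adelic := Measure.haar with hμ
  obtain ⟨β', hβ'⟩ := exists_isCoveringWeight (borelAdelic F E c 3 ⊓ (quasiSplit F E c 3).arithmeticSubgroup)
  obtain ⟨β, hβ⟩ := exists_isCoveringWeight (quasiSplit F E c 3).arithmeticSubgroup
  -- the compact neighbourhood `C`, its smear `A`; E4; multiplicity; floor
  obtain ⟨C, hCc, hC1⟩ := exists_compact_mem_nhds (1 : (quasiSplit F E c 3).Adelic)
  have hC0 : μ C ≠ 0 := (measure_pos_of_mem_nhds μ hC1).ne'
  have hCtop : μ C ≠ ∞ := hCc.measure_lt_top.ne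
  obtain ⟨A, hA1, hA⟩ := exists_smear_borelHeight hIw hCc
  obtain ⟨K', -, hK't, hE4⟩ := exists_siegelIntegral_eq_mul_rpow_three h2 hc hc1 μ hIw hτ
  obtain ⟨M₁, hM₁, hmult⟩ := exists_forall_ncard_le_mul_borelHeight_sq_siegel hc hc1 hIw hΩc hΩB hKc ht hCc
  obtain ⟨c𝔖, AK, hc𝔖, -, hfl⟩ := exists_floor_and_smear_siegel hIw hΩc hΩB hKc ht
  have hA0 : (0 : ℝ) ≤ A := A.coe_nonneg
  have hτ2 : 0 ≤ τ - 2 := by linarith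
  -- the ceiling constant `c' = max 1 (c_𝔖²)⁻¹` and the final constant
  set c' : ℝ := max 1 (c𝔖 ^ 2)⁻¹ with hc'
  have hc'1 : 1 ≤ c' := le_max_left _ _
  have hc'0 : 0 ≤ c' := zero_le_one.trans hc'1
  refine ⟨(A : ℝ) ^ τ * (M₁ * 1) / (μ C).toReal * (K'.toReal * (((A : ℝ) * c') ^ (τ - 2))), by positivity, fun ω hω a ha k hk => ?_⟩
  obtain ⟨hflo, -, -⟩ := hfl ω hω a ha k hk
  set g : (quasiSplit F E c 3).Adelic := ω * a * k with hg
  have hHpos : 0 < (borelHeight g : ℝ) := hc𝔖.trans_le hflo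
  have hH0 : 0 ≤ (borelHeight g : ℝ) := hHpos.le
  -- the ceiling `C₀ = max (H g) (H g)⁻¹ ≤ c'·H(g)`
  set C₀ : ℝ≥0 := max (borelHeight g) (borelHeight g)⁻¹ with hC₀
  have hceil : ∀ γ : (quasiSplit F E c 3).Rational, borelHeight ((quasiSplit F E c 3).toAdelic γ * g) ≤ C₀ := fun γ =>
    borelHeight_toAdelic_mul_le_max_three γ g
  have hC₀le : (C₀ : ℝ) ≤ c' * (borelHeight g : ℝ) := by
    rw [hC₀, NNReal.coe_max, NNReal.coe_inv]
    refine max_le (le_mul_of_one_le_left hH0 hc'1) ?_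
    have hsq : c𝔖 ^ 2 ≤ (borelHeight g : ℝ) ^ 2 := pow_le_pow_left₀ hc𝔖.le hflo 2
    calc ((borelHeight g : ℝ))⁻¹ = (borelHeight g : ℝ) / (borelHeight g : ℝ) ^ 2 := by field_simp
      _ ≤ (borelHeight g : ℝ) / c𝔖 ^ 2 := div_le_div_of_nonneg_left hH0 (by positivity) hsq
      _ = (c𝔖 ^ 2)⁻¹ * (borelHeight g : ℝ) := by ring
      _ ≤ c' * (borelHeight g : ℝ) := mul_le_mul_of_nonneg_right (le_max_right _ _) hH0
  -- the two truncated powers of the height and the smear `ψ₁(y) ≤ A^τ ψ₂(y c)`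
  set ψ₁ : (quasiSplit F E c 3).Adelic → ℝ≥0∞ := {y | borelHeight y ≤ C₀}.indicator fun y => ENNReal.ofReal ((borelHeight y : ℝ) ^ τ) with hψ₁
  set ψ₂ : (quasiSplit F E c 3).Adelic → ℝ≥0∞ := {y | borelHeight y ≤ A * C₀}.indicator fun y => ENNReal.ofReal ((borelHeight y : ℝ) ^ τ) with hψ₂
  have hpow : Measurable fun y : (quasiSplit F E c 3).Adelic => ENNReal.ofReal ((borelHeight y : ℝ) ^ τ) :=
    ENNReal.measurable_ofReal.comp ((measurable_borelHeight.coe_nnreal_real).pow_const τ)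
  have hψ₂m : Measurable ψ₂ := hpow.indicator (isClosed_setOf_borelHeight_le _).measurableSet
  have hψ₂inv : ∀ γ ∈ borelAdelic F E c 3 ⊓ (quasiSplit F E c 3).arithmeticSubgroup, ∀ y : (quasiSplit F E c 3).Adelic, ψ₂ (γ * y) = ψ₂ y := fun γ hγ y => by
    simp only [hψ₂, Set.indicator_apply, Set.mem_setOf_eq, borelHeight_mul_of_mem_inf hγ y]
  have hsm : ∀ y : (quasiSplit F E c 3).Adelic, ∀ c₁ ∈ C, ψ₁ y ≤ ENNReal.ofReal ((A : ℝ) ^ τ) * ψ₂ (y * c₁) := by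
    intro y c₁ hc₁
    by_cases hy : borelHeight y ≤ C₀
    · have h1 : borelHeight (y * c₁) ≤ A * C₀ := (hA y c₁ hc₁).1.trans (mul_le_mul_right hy A)
      rw [hψ₁, hψ₂, indicator_of_mem (show y ∈ {y | borelHeight y ≤ C₀} from hy), indicator_of_mem (show y * c₁ ∈ {y | borelHeight y ≤ A * C₀} from h1),
        ← ENNReal.ofReal_mul (Real.rpow_nonneg A.coe_nonneg τ), ← Real.mul_rpow A.coe_nonneg (borelHeight (y * c₁)).coe_nonneg]
      exact ENNReal.ofReal_le_ofReal (Real.rpow_le_rpow (borelHeight y).coe_nonneg (by exact_mod_cast (hA y c₁ hc₁).2) (by linarith))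
    · rw [hψ₁, indicator_of_notMem (show y ∉ {y | borelHeight y ≤ C₀} from hy)]
      exact zero_le
  -- the multiplicity `m_g = #(G(F) ∩ (g•C)(g•C)⁻¹) ≤ M₁·H(g)²`
  have hfin : (((quasiSplit F E c 3).arithmeticSubgroup : Set (quasiSplit F E c 3).Adelic) ∩ ((g • C) * (g • C)⁻¹)).Finite :=
    finite_coe_inter_of_isCompact (quasiSplit F E c 3).arithmeticSubgroup ((hCc.smul g).mul (hCc.smul g).inv)
  set m : ℕ := (((quasiSplit F E c 3).arithmeticSubgroup : Set (quasiSplit F E c 3).Adelic) ∩ ((g • C) * (g • C)⁻¹)).ncard with hm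
  have hmcov : ∀ y : (quasiSplit F E c 3).Adelic, coveringSum (quasiSplit F E c 3).arithmeticSubgroup ((g • C).indicator 1) y ≤ m :=
    coveringSum_indicator_le_ncard (quasiSplit F E c 3).arithmeticSubgroup hfin
  have hmle : (m : ℝ) ≤ M₁ * ((borelHeight g : ℝ) * (borelHeight g : ℝ)) := hmult ω hω a ha k hk
  -- the quantitative E4 at the cut-off `A·C₀`
  have hI : ∫⁻ y, ψ₂ y * β' y ∂μ = K' * ENNReal.ofReal ((((A * C₀ : ℝ≥0)) : ℝ) ^ (τ - 2)) := hE4 hβ' (A * C₀)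
  have hItop : ∫⁻ y, ψ₂ y * β' y ∂μ ≠ ∞ := by rw [hI]; exact ENNReal.mul_ne_top hK't ENNReal.ofReal_ne_top
  -- the engine
  have hmain := summable_toReal_of_lintegral_weight_ne_top μ (quasiSplit F E c 3).arithmeticSubgroup
    (borelAdelic F E c 3 ⊓ (quasiSplit F E c 3).arithmeticSubgroup) inf_le_right
    (s := fun q : Quotient (orbitRel ↥(borelU (c : E →+* E) ((StdForm.antidiagonal 3).over E)) ↥(unitaryGroupOfForm (c : E →+* E) ((StdForm.antidiagonal 3).over E))) =>
      (quasiSplit F E c 3).toAdelic (Quotient.out q : ↥(unitaryGroupOfForm (c : E →+* E) ((StdForm.antidiagonal 3).over E))))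
    toAdelic_out_mem_arithmeticSubgroup (fun γ hγ => existsUnique_borelQuotient hγ) (ψ₁ := ψ₁) (ψ₂ := ψ₂)
    (fun y => ne_top_of_le_ne_top ENNReal.ofReal_ne_top (indicator_le_self _ _ y)) hψ₂m hψ₂inv hCc.measurableSet hC0 hCtop ENNReal.ofReal_ne_top hsm hβ hβ' hItop g hmcov
  -- the terms: `ψ₁(γ̃_q g).toReal = H(γ̃_q g)^τ` (the ceiling)
  have hterm : ∀ q : Quotient (orbitRel ↥(borelU (c : E →+* E) ((StdForm.antidiagonal 3).over E)) ↥(unitaryGroupOfForm (c : E →+* E) ((StdForm.antidiagonal 3).over E))),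
      (ψ₁ ((quasiSplit F E c 3).toAdelic (Quotient.out q : ↥(unitaryGroupOfForm (c : E →+* E) ((StdForm.antidiagonal 3).over E))) * g)).toReal =
        ((borelHeight ((quasiSplit F E c 3).toAdelic (Quotient.out q : ↥(unitaryGroupOfForm (c : E →+* E) ((StdForm.antidiagonal 3).over E))) * g) : ℝ)) ^ τ := by
    intro q
    simp only [hψ₁]
    rw [indicator_of_mem (show _ ∈ {y : (quasiSplit F E c 3).Adelic | borelHeight y ≤ C₀} from hceil _)]
    exact ENNReal.toReal_ofReal (Real.rpow_nonneg (NNReal.coe_nonneg _) τ)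
  refine ⟨hmain.1.congr hterm, ?_⟩
  rw [← tsum_congr hterm]
  refine hmain.2.trans ?_
  -- evaluate the right-hand side in `ℝ`
  have hAC₀ : 0 ≤ ((A * C₀ : ℝ≥0) : ℝ) := NNReal.coe_nonneg _
  rw [hI, ENNReal.toReal_mul, ENNReal.toReal_div, ENNReal.toReal_mul, ENNReal.toReal_mul, ENNReal.toReal_ofReal (Real.rpow_nonneg hA0 τ), ENNReal.toReal_natCast,
    ENNReal.toReal_ofReal (Real.rpow_nonneg hAC₀ _)]
  -- `(A C₀)^{τ-2} ≤ (A c')^{τ-2} · H(g)^{τ-2}` and `m ≤ M₁ H(g)²`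
  have h6 : (((A * C₀ : ℝ≥0)) : ℝ) ^ (τ - 2) ≤ ((A : ℝ) * c') ^ (τ - 2) * (borelHeight g : ℝ) ^ (τ - 2) := by
    rw [← Real.mul_rpow (mul_nonneg hA0 hc'0) hH0, NNReal.coe_mul]
    refine Real.rpow_le_rpow hAC₀ ?_ hτ2
    rw [mul_assoc]
    exact mul_le_mul_of_nonneg_left hC₀le hA0
  have h5 : (A : ℝ) ^ τ * (m : ℝ) / (μ C).toReal ≤ (A : ℝ) ^ τ * (M₁ * ((borelHeight g : ℝ) * (borelHeight g : ℝ))) / (μ C).toReal :=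
    div_le_div_of_nonneg_right (mul_le_mul_of_nonneg_left hmle (Real.rpow_nonneg hA0 τ)) ENNReal.toReal_nonneg
  have hHτ : (borelHeight g : ℝ) * (borelHeight g : ℝ) * (borelHeight g : ℝ) ^ (τ - 2) = (borelHeight g : ℝ) ^ τ := by
    rw [← sq, ← Real.rpow_two, ← Real.rpow_add hHpos]
    congr 1
    ring
  calc (A : ℝ) ^ τ * (m : ℝ) / (μ C).toReal * (K'.toReal * (((A * C₀ : ℝ≥0)) : ℝ) ^ (τ - 2))
      ≤ (A : ℝ) ^ τ * (M₁ * ((borelHeight g : ℝ) * (borelHeight g : ℝ))) / (μ C).toReal * (K'.toReal * (((A : ℝ) * c') ^ (τ - 2) * (borelHeight g : ℝ) ^ (τ - 2))) :=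
        mul_le_mul h5 (mul_le_mul_of_nonneg_left h6 ENNReal.toReal_nonneg) (by positivity) (by positivity)
    _ = (A : ℝ) ^ τ * (M₁ * 1) / (μ C).toReal * (K'.toReal * (((A : ℝ) * c') ^ (τ - 2))) *
          ((borelHeight g : ℝ) * (borelHeight g : ℝ) * (borelHeight g : ℝ) ^ (τ - 2)) := by ring
    _ = (A : ℝ) ^ τ * (M₁ * 1) / (μ C).toReal * (K'.toReal * (((A : ℝ) * c') ^ (τ - 2))) * (borelHeight g : ℝ) ^ τ := by rw [hHτ]

/-- **THE SAME ON THE SIEGEL SET AS A SET**: `∀ g ∈ 𝔖 = Ω · val⁻¹(siegelCone 3 E t) · K`, `Summable (q ↦ H(γ̃_q g)^τ) ∧ Σ'_q H(γ̃_q g)^τ ≤ A′·H(g)^τ` — the letters of ★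
`K2E1ReductionTheoryU3.exists_siegel_cover_three` (`G(F)·𝔖 = G(𝔸)`) and of ★ R6e `K2E1TruncatedEisensteinL2` (`hcov`, `hmod` on `𝔖`). [cite: MoeglinWaldspurger1995, II.1.5 and I.2.13]
[cite: Garrett2018, §3.10–3.11] -/
theorem exists_forall_mem_siegel_tsum_borelHeight_rpow_le (h2 : Module.finrank F E = 2) (hc : c * c = 1) (hc1 : c ≠ 1)
    (hIw : ∀ g : (quasiSplit F E c 3).Adelic, ∃ b ∈ borelAdelic F E c 3, ∃ k : (quasiSplit F E c 3).Adelic,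
      adelicVal F E c 3 ((StdForm.antidiagonal 3).over E) k ∈ standardMaximalCompactGL 3 E ∧ g = b * k)
    {Ω : Set (quasiSplit F E c 3).Adelic} (hΩc : IsCompact Ω) (hΩB : Ω ⊆ (borelAdelic F E c 3 : Set (quasiSplit F E c 3).Adelic))
    {K : Set (quasiSplit F E c 3).Adelic} (hKc : IsCompact K) {t : ℝ} (ht : 0 < t) {τ : ℝ} (hτ : 2 < τ) :
    ∃ A₁ : ℝ, 0 ≤ A₁ ∧ ∀ g ∈ Ω * (adelicVal F E c 3 ((StdForm.antidiagonal 3).over E) ⁻¹' siegelCone 3 E t) * K,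
      Summable (fun q : Quotient (orbitRel ↥(borelU (c : E →+* E) ((StdForm.antidiagonal 3).over E)) ↥(unitaryGroupOfForm (c : E →+* E) ((StdForm.antidiagonal 3).over E))) =>
        ((borelHeight ((quasiSplit F E c 3).toAdelic (Quotient.out q : ↥(unitaryGroupOfForm (c : E →+* E) ((StdForm.antidiagonal 3).over E))) * g) : ℝ)) ^ τ) ∧
      ∑' q : Quotient (orbitRel ↥(borelU (c : E →+* E) ((StdForm.antidiagonal 3).over E)) ↥(unitaryGroupOfForm (c : E →+* E) ((StdForm.antidiagonal 3).over E))),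
          ((borelHeight ((quasiSplit F E c 3).toAdelic (Quotient.out q : ↥(unitaryGroupOfForm (c : E →+* E) ((StdForm.antidiagonal 3).over E))) * g) : ℝ)) ^ τ ≤
        A₁ * ((borelHeight g : ℝ)) ^ τ := by
  obtain ⟨A₁, hA₁, h⟩ := exists_forall_tsum_borelHeight_rpow_le_siegel h2 hc hc1 hIw hΩc hΩB hKc ht hτ
  refine ⟨A₁, hA₁, ?_⟩
  rintro g ⟨x, ⟨ω, hω, a, ha, rfl⟩, k, hk, rfl⟩
  exact h ω hω a ha k hk

/-- **PACKAGED WITH REDUCTION THEORY**: for `[E:F] = 2`, `c² = 1 ≠ c`, Iwasawa and `τ > 2` there is a Siegel set `𝔖 = Ω·A(t)·K` with `G(F)·𝔖 = G(𝔸)` (★ `exists_siegel_cover_three`) and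
`A′ ≥ 0` with `Σ'_q H(γ̃_q g)^τ ≤ A′·H(g)^τ` (summable) for every `g ∈ 𝔖`. [cite: MoeglinWaldspurger1995, II.1.5 and I.2.13] [cite: Borel1963, §5] [cite: Godement1964, §8] -/
theorem exists_siegel_cover_tsum_borelHeight_rpow_le_three (h2 : Module.finrank F E = 2) (hc : c * c = 1) (hc1 : c ≠ 1)
    (hIw : ∀ g : (quasiSplit F E c 3).Adelic, ∃ b ∈ borelAdelic F E c 3, ∃ k : (quasiSplit F E c 3).Adelic,
      adelicVal F E c 3 ((StdForm.antidiagonal 3).over E) k ∈ standardMaximalCompactGL 3 E ∧ g = b * k)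
    {τ : ℝ} (hτ : 2 < τ) :
    ∃ 𝔖 : Set (quasiSplit F E c 3).Adelic,
      ((quasiSplit F E c 3).arithmeticSubgroup : Set (quasiSplit F E c 3).Adelic) * 𝔖 = Set.univ ∧
      ∃ A₁ : ℝ, 0 ≤ A₁ ∧ ∀ g ∈ 𝔖,
        Summable (fun q : Quotient (orbitRel ↥(borelU (c : E →+* E) ((StdForm.antidiagonal 3).over E)) ↥(unitaryGroupOfForm (c : E →+* E) ((StdForm.antidiagonal 3).over E))) =>
          ((borelHeight ((quasiSplit F E c 3).toAdelic (Quotient.out q : ↥(unitaryGroupOfForm (c : E →+* E) ((StdForm.antidiagonal 3).over E))) * g) : ℝ)) ^ τ) ∧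
        ∑' q : Quotient (orbitRel ↥(borelU (c : E →+* E) ((StdForm.antidiagonal 3).over E)) ↥(unitaryGroupOfForm (c : E →+* E) ((StdForm.antidiagonal 3).over E))),
            ((borelHeight ((quasiSplit F E c 3).toAdelic (Quotient.out q : ↥(unitaryGroupOfForm (c : E →+* E) ((StdForm.antidiagonal 3).over E))) * g) : ℝ)) ^ τ ≤
          A₁ * ((borelHeight g : ℝ)) ^ τ := by
  obtain ⟨Ω, K, t, ht, hΩN, hΩc, hKc, hcov⟩ := exists_siegel_cover_three h2 hc1 hc hIw
  obtain ⟨A₁, hA₁, h⟩ := exists_forall_mem_siegel_tsum_borelHeight_rpow_le h2 hc hc1 hIw hΩc (subset_borelAdelic_of_image_subset hΩN) hKc ht hτ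
  exact ⟨_, hcov, A₁, hA₁, h⟩

/-- **THE CM PAIR `(L⁺, L, c)`, NO HYPOTHESIS LEFT**: for a CM field `L` and `τ > 2` there are a Siegel set `𝔖` of `U(J₃)(𝔸_{L⁺})` with `G(L⁺)·𝔖 = G(𝔸)` and `A′ ≥ 0` with
`Σ'_q H(γ̃_q g)^τ ≤ A′·H(g)^τ` for every `g ∈ 𝔖` (Iwasawa ★ `exists_mem_borelAdelic_mul_mem_standardMaximalCompactGL_cm_three`, `[L:L⁺] = 2`, `c² = 1 ≠ c` Mathlib).
[cite: MoeglinWaldspurger1995, II.1.5 and I.2.13] [cite: Rogawski1990, §2.2 (p. 13)] -/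
theorem exists_siegel_cover_tsum_borelHeight_rpow_le_cm_three (L : Type) [Field L] [NumberField L] [IsCMField L] {τ : ℝ} (hτ : 2 < τ) :
    ∃ 𝔖 : Set (quasiSplit (↥(maximalRealSubfield L)) L (IsCMField.complexConj L) 3).Adelic,
      ((quasiSplit (↥(maximalRealSubfield L)) L (IsCMField.complexConj L) 3).arithmeticSubgroup :
          Set (quasiSplit (↥(maximalRealSubfield L)) L (IsCMField.complexConj L) 3).Adelic) * 𝔖 = Set.univ ∧
      ∃ A₁ : ℝ, 0 ≤ A₁ ∧ ∀ g ∈ 𝔖,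
        Summable (fun q : Quotient (orbitRel ↥(borelU ((IsCMField.complexConj L : L ≃ₐ[↥(maximalRealSubfield L)] L) : L →+* L) ((StdForm.antidiagonal 3).over L))
            ↥(unitaryGroupOfForm ((IsCMField.complexConj L : L ≃ₐ[↥(maximalRealSubfield L)] L) : L →+* L) ((StdForm.antidiagonal 3).over L))) =>
          ((borelHeight ((quasiSplit (↥(maximalRealSubfield L)) L (IsCMField.complexConj L) 3).toAdelic
            (Quotient.out q : ↥(unitaryGroupOfForm ((IsCMField.complexConj L : L ≃ₐ[↥(maximalRealSubfield L)] L) : L →+* L) ((StdForm.antidiagonal 3).over L))) * g) : ℝ)) ^ τ) ∧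
        ∑' q : Quotient (orbitRel ↥(borelU ((IsCMField.complexConj L : L ≃ₐ[↥(maximalRealSubfield L)] L) : L →+* L) ((StdForm.antidiagonal 3).over L))
            ↥(unitaryGroupOfForm ((IsCMField.complexConj L : L ≃ₐ[↥(maximalRealSubfield L)] L) : L →+* L) ((StdForm.antidiagonal 3).over L))),
            ((borelHeight ((quasiSplit (↥(maximalRealSubfield L)) L (IsCMField.complexConj L) 3).toAdelic
              (Quotient.out q : ↥(unitaryGroupOfForm ((IsCMField.complexConj L : L ≃ₐ[↥(maximalRealSubfield L)] L) : L →+* L) ((StdForm.antidiagonal 3).over L))) * g) : ℝ)) ^ τ ≤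
          A₁ * ((borelHeight g : ℝ)) ^ τ :=
  exists_siegel_cover_tsum_borelHeight_rpow_le_three (Algebra.IsQuadraticExtension.finrank_eq_two (↥(maximalRealSubfield L)) L)
    (AlgEquiv.ext fun x => IsCMField.complexConj_apply_apply L x) (IsCMField.complexConj_ne_one L) (exists_mem_borelAdelic_mul_mem_standardMaximalCompactGL_cm_three L) hτ

end Head

/-! ## §2 The Eisenstein currency: `‖E(f_z)(g)‖ ≤ ‖φ‖_∞ · A′ · H(g)^{Re z}` on `𝔖`, and the `ℕ`-exponent form of R6e's `hmod` -/

section Eisenstein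

/-- **MODERATE GROWTH OF THE BOREL EISENSTEIN SERIES OF `U(J₃)` ON A SIEGEL SET.**  `[E:F] = 2`, `c² = 1 ≠ c`, Iwasawa; `Ω ⊆ B(𝔸_F)`, `K` compact, `t > 0`; `Re z > 2`.  There is `A′ ≥ 0` such
that for every bounded coefficient `φ` (`‖φ‖ ≤ M_φ`) and every `g ∈ 𝔖 = Ω·A(t)·K`:
  `‖eisensteinSeriesU (flatSectionU φ z) g‖ ≤ M_φ · A′ · H(g)^{Re z}`
(`E(f_z)(g) = Σ'_q f_z(γ̃_q g)`, `‖f_z(x)‖ ≤ M_φ H(x)^{Re z}` ★ `norm_flatSectionU_le`, absolute convergence ★ `summable_norm_flatSectionU_of_summable`, §1).  This is R6e's `hmod` ∕ R7's growth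
input for `φ = E(f_z)`. [cite: MoeglinWaldspurger1995, II.1.5 and I.2.13] [cite: Garrett2018, §3.10–3.11] [cite: Godement1964, §8] -/
theorem exists_forall_norm_eisensteinSeriesU_le_siegel (h2 : Module.finrank F E = 2) (hc : c * c = 1) (hc1 : c ≠ 1)
    (hIw : ∀ g : (quasiSplit F E c 3).Adelic, ∃ b ∈ borelAdelic F E c 3, ∃ k : (quasiSplit F E c 3).Adelic,
      adelicVal F E c 3 ((StdForm.antidiagonal 3).over E) k ∈ standardMaximalCompactGL 3 E ∧ g = b * k)
    {Ω : Set (quasiSplit F E c 3).Adelic} (hΩc : IsCompact Ω) (hΩB : Ω ⊆ (borelAdelic F E c 3 : Set (quasiSplit F E c 3).Adelic))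
    {K : Set (quasiSplit F E c 3).Adelic} (hKc : IsCompact K) {t : ℝ} (ht : 0 < t) {z : ℂ} (hz : 2 < z.re) :
    ∃ A₁ : ℝ, 0 ≤ A₁ ∧ ∀ {φ : (quasiSplit F E c 3).Adelic → ℂ} {Mφ : ℝ}, (∀ x, ‖φ x‖ ≤ Mφ) →
      ∀ g ∈ Ω * (adelicVal F E c 3 ((StdForm.antidiagonal 3).over E) ⁻¹' siegelCone 3 E t) * K,
        ‖eisensteinSeriesU (flatSectionU φ z) g‖ ≤ Mφ * A₁ * ((borelHeight g : ℝ)) ^ z.re := by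
  obtain ⟨A₁, hA₁, h⟩ := exists_forall_mem_siegel_tsum_borelHeight_rpow_le h2 hc hc1 hIw hΩc hΩB hKc ht hz
  refine ⟨A₁, hA₁, fun {φ} {Mφ} hφ g hg => ?_⟩
  obtain ⟨hsum, hle⟩ := h g hg
  have hM0 : 0 ≤ Mφ := (norm_nonneg _).trans (hφ 1)
  have hsn := summable_norm_flatSectionU_of_summable hφ (z := z)
    (y := fun q : Quotient (orbitRel ↥(borelU (c : E →+* E) ((StdForm.antidiagonal 3).over E)) ↥(unitaryGroupOfForm (c : E →+* E) ((StdForm.antidiagonal 3).over E))) =>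
      (quasiSplit F E c 3).toAdelic (Quotient.out q : ↥(unitaryGroupOfForm (c : E →+* E) ((StdForm.antidiagonal 3).over E))) * g) hsum
  rw [eisensteinSeriesU_def]
  refine (norm_tsum_le_tsum_norm hsn).trans ?_
  calc ∑' q : Quotient (orbitRel ↥(borelU (c : E →+* E) ((StdForm.antidiagonal 3).over E)) ↥(unitaryGroupOfForm (c : E →+* E) ((StdForm.antidiagonal 3).over E))),
        ‖flatSectionU φ z ((quasiSplit F E c 3).toAdelic (Quotient.out q : ↥(unitaryGroupOfForm (c : E →+* E) ((StdForm.antidiagonal 3).over E))) * g)‖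
      ≤ ∑' q : Quotient (orbitRel ↥(borelU (c : E →+* E) ((StdForm.antidiagonal 3).over E)) ↥(unitaryGroupOfForm (c : E →+* E) ((StdForm.antidiagonal 3).over E))),
          Mφ * ((borelHeight ((quasiSplit F E c 3).toAdelic (Quotient.out q : ↥(unitaryGroupOfForm (c : E →+* E) ((StdForm.antidiagonal 3).over E))) * g) : ℝ)) ^ z.re :=
        Summable.tsum_le_tsum (fun q => norm_flatSectionU_le hφ z _) hsn (hsum.mul_left Mφ)
    _ = Mφ * ∑' q : Quotient (orbitRel ↥(borelU (c : E →+* E) ((StdForm.antidiagonal 3).over E)) ↥(unitaryGroupOfForm (c : E →+* E) ((StdForm.antidiagonal 3).over E))),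
          ((borelHeight ((quasiSplit F E c 3).toAdelic (Quotient.out q : ↥(unitaryGroupOfForm (c : E →+* E) ((StdForm.antidiagonal 3).over E))) * g) : ℝ)) ^ z.re :=
        tsum_mul_left
    _ ≤ Mφ * (A₁ * ((borelHeight g : ℝ)) ^ z.re) := mul_le_mul_of_nonneg_left hle hM0
    _ = Mφ * A₁ * ((borelHeight g : ℝ)) ^ z.re := (mul_assoc _ _ _).symm

/-- **`H(g)^τ ≤ max 1 (c^{τ−n}) · H(g)^n` when `0 < c ≤ H(g)` and `τ ≤ n`** (the floor converts a real exponent into the natural exponent of ★ R6e's `hmod`). [folklore] -/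
theorem rpow_le_max_mul_pow_of_le {c H τ : ℝ} {n : ℕ} (hc : 0 < c) (hcH : c ≤ H) (hτn : τ ≤ n) :
    H ^ τ ≤ max 1 (c ^ (τ - n)) * H ^ n := by
  have hH : 0 < H := hc.trans_le hcH
  have hsplit : H ^ τ = H ^ (τ - n) * H ^ n := by
    rw [← Real.rpow_natCast H n, ← Real.rpow_add hH]
    congr 1
    ring
  rw [hsplit]
  refine mul_le_mul_of_nonneg_right ?_ (pow_nonneg hH.le n)
  rcases le_or_gt 1 H with h1 | h1
  · exact (Real.rpow_le_one_of_one_le_of_nonpos h1 (by linarith)).trans (le_max_left _ _)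
  · exact (Real.rpow_le_rpow_of_nonpos hc hcH (by linarith)).trans (le_max_right _ _)

/-- **THE `ℕ`-EXPONENT FORM (R6e's `hmod` binder ★ `K2E1TruncatedEisensteinL2.exists_bound_low_of_moderateGrowth`)**: for `Re z > 2` and `n ≥ Re z` there is `A″ ≥ 0` with
`‖eisensteinSeriesU (flatSectionU φ z) g‖ ≤ (M_φ · A″) · H(g)^n` for every bounded `φ` (`‖φ‖ ≤ M_φ`) and every `g ∈ 𝔖` (§2 head + the floor `H ≥ c_𝔖` on `𝔖`).
[cite: MoeglinWaldspurger1995, I.2.13 and II.1.5] [cite: Garrett2018, §3.10–3.11] -/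
theorem exists_forall_norm_eisensteinSeriesU_le_pow_siegel (h2 : Module.finrank F E = 2) (hc : c * c = 1) (hc1 : c ≠ 1)
    (hIw : ∀ g : (quasiSplit F E c 3).Adelic, ∃ b ∈ borelAdelic F E c 3, ∃ k : (quasiSplit F E c 3).Adelic,
      adelicVal F E c 3 ((StdForm.antidiagonal 3).over E) k ∈ standardMaximalCompactGL 3 E ∧ g = b * k)
    {Ω : Set (quasiSplit F E c 3).Adelic} (hΩc : IsCompact Ω) (hΩB : Ω ⊆ (borelAdelic F E c 3 : Set (quasiSplit F E c 3).Adelic))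
    {K : Set (quasiSplit F E c 3).Adelic} (hKc : IsCompact K) {t : ℝ} (ht : 0 < t) {z : ℂ} (hz : 2 < z.re) {n : ℕ} (hn : z.re ≤ n) :
    ∃ A₂ : ℝ, 0 ≤ A₂ ∧ ∀ {φ : (quasiSplit F E c 3).Adelic → ℂ} {Mφ : ℝ}, (∀ x, ‖φ x‖ ≤ Mφ) →
      ∀ g ∈ Ω * (adelicVal F E c 3 ((StdForm.antidiagonal 3).over E) ⁻¹' siegelCone 3 E t) * K,
        ‖eisensteinSeriesU (flatSectionU φ z) g‖ ≤ Mφ * A₂ * ((borelHeight g : ℝ)) ^ n := by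
  obtain ⟨A₁, hA₁, h⟩ := exists_forall_norm_eisensteinSeriesU_le_siegel h2 hc hc1 hIw hΩc hΩB hKc ht hz
  obtain ⟨c𝔖, AK, hc𝔖, -, hfl⟩ := exists_floor_and_smear_siegel hIw hΩc hΩB hKc ht
  refine ⟨A₁ * max 1 (c𝔖 ^ (z.re - n)), by positivity, fun {φ} {Mφ} hφ g hg => ?_⟩
  have hM0 : 0 ≤ Mφ := (norm_nonneg _).trans (hφ 1)
  obtain ⟨x, ⟨ω, hω, a, ha, rfl⟩, k, hk, rfl⟩ := hg
  have hflo := (hfl ω hω a ha k hk).1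
  calc ‖eisensteinSeriesU (flatSectionU φ z) (ω * a * k)‖ ≤ Mφ * A₁ * ((borelHeight (ω * a * k) : ℝ)) ^ z.re :=
        h hφ (ω * a * k) (Set.mul_mem_mul (Set.mul_mem_mul hω ha) hk)
    _ ≤ Mφ * A₁ * (max 1 (c𝔖 ^ (z.re - n)) * ((borelHeight (ω * a * k) : ℝ)) ^ n) :=
        mul_le_mul_of_nonneg_left (rpow_le_max_mul_pow_of_le hc𝔖 hflo hn) (mul_nonneg hM0 hA₁)
    _ = Mφ * (A₁ * max 1 (c𝔖 ^ (z.re - n))) * ((borelHeight (ω * a * k) : ℝ)) ^ n := by ring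

end Eisenstein

end Summit.HodgeConjecture.HodgeConjecture.Cruxes.H413.K2E1BorelEisensteinModerateGrowth

end
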